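import Literature.NumberTheory.EllipticCurves.Castella2018.AnticyclotomicMainConjectureErratum
import HarnessLib

/-!
# Castella's erratum Thm. 1.1 (= arXiv:2409.01360 Thm. 3.1) at `p ∥ N`, RE-ORIENTED: the `Λ`-adic
# partner of the tree's BDP frame `IsBDPLFunction ι 𝔭` (`ι` inducing `𝔭`) is `X_ac` STRICT AT THE
# OTHER PRIME `𝔭̄` — the correctly oriented twin of
# `erratumThm11_exists_isBDPLFunction_isTorsion_charIdeal_eq_OPEN` (UNREFEREED, `_OPEN`)

HONEST FRAMING (typing layer `bsd-littype`, seat `bsd-littype-05`; bsd-eis RULING L33, 2026-08-27,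
erratum target E6 of the (C4) orientation verdict): an UNREFEREED result enters the tree only as an
explicitly labelled OPEN hypothesis (`def … : Prop`, suffix `_OPEN`, tag `[claim: …, status:
under-review]`), NEVER as a theorem; every result using it is CONDITIONAL; nothing is asserted about
any curve; BSD is not proved by any of this. ONE new named `Prop` (D-0014 accounting: +1 unproved,
claim-tagged) and small PROVED API; no `sorry`. The sibling file
`AnticyclotomicMainConjectureErratum.lean` (its source quotations, provenance chain, dictionary and
flags `Err11-*`) is imported and NOT restated; its fact is KEPT (importers) and is not changed in
meaning — this file adds the twin with the Selmer slot moved to `𝔭̄`, and says why.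

## What was mis-oriented, in one paragraph (tree predicates only; print locators below)

The sibling fact transcribes the erratum's Thm. 1.1 LITERALLY: [Castella2018] Def. 2.2's
`X_ac = X_𝔭` (dual of the Selmer group STRICT at `𝔭`, relaxed at `𝔭̄`; tree
`AcSelmer.XAc … 𝔭 ∅ γ`, whose `Λ`-action is PRECOMPOSITION, `(T·x)(s) = x(conj_γ s) − x(s)`,
`AcSelmer.XAc.X_smul_apply`) glued to [Castella2018] Thm. 3.1's DISPLAY for `L_p(f)` (infinity type
`(−n, n)`, `n > 0`, multiplier `(1 − a_p p⁻¹ φ(𝔭) + ε_p φ(𝔭)²)²` AT `𝔭`; tree `IsBDPLFunction ι 𝔭`,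
`BDPAnticyclotomicPAdicLFunction.lean`). In the tree's dictionary (module docstring there) a
character `φ` in the range of `IsBDPLFunction ι 𝔭` has Castella–Hsieh infinity type `(−n, n)` read
through the embedding inducing `𝔭`, so its `p`-adic avatar `r` (`IsPAdicAvatarOf ι φ r`:
`r(Frob_v^geom) = ι⁻¹(φ(ϖ_v))`, Castella–Hsieh's `φ̂ ∘ rec_K`) restricts to `G_{K_𝔭}` as an
unramified twist of `ε_cyc^{−n}` and to `G_{K_𝔭̄}` as an unramified twist of `ε_cyc^{n}`
([CastellaHsieh2018] §3.3: "if `ρ_𝔸` is unramified at `𝔭` and of infinity type `(m, n)`, then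
`ρ|_{G_{K_𝔭}}` is an unramified twist of the `m`-th power of the `p`-adic cyclotomic character";
here `m = −n`). The fibre of the precomposition dual `X_{str 𝔮}` at `r` is dual to the
`r⁻¹`-EIGENSPACE of the Selmer group over `K_∞`, i.e. (up to finite defect) to
`Sel_{str 𝔮}(K, E[p^∞] ⊗ r⁻¹)`; and `V_pE ⊗ r⁻¹` has Hodge–Tate weights `{n, n+1}` at `𝔭`
(Bloch–Kato condition `H¹_f = H¹`: RELAXED) and `{−n, −n+1}` at `𝔭̄` (`H¹_f = 0`: STRICT)
[BlochKato1990, §3]. Hence Greenberg's recipe — the one these main conjectures instantiate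
([CastellaGrossiLeeSkinner2022] §1.4: "a special case of Greenberg's main conjectures") — pairs the
tree frame at `(ι, 𝔭)` with `X_ac` STRICT AT `𝔭̄` = `AcSelmer.XAc … 𝔭̄ ∅ γ`. RULE (tree,
precomposition duals): the strict prime of `XAc` is the prime OPPOSITE to the one the frame's
embedding datum induces. This is the layout of every correctly oriented binder already in the tree
("family B"): `KellerYin2024.thmD_imcMult_exists_isBDPLFunction_isTorsion_charIdeal_eq_OPEN`
(`IsBDPLFunction ι' v` with `XAc … vbar`), `CastellaGrossiLeeSkinner2022.proofThm422_…`. The sibling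
fact ("family A": frame at `(ι, 𝔭)` with `XAc … 𝔭`) therefore states the `γ ↦ γ⁻¹`-CONJUGATE of
print's main conjecture (equal to it only where the characteristic ideal is invariant under the
involution of `Λ`, an unprinted condition); at `T = 0` (all booked consumers) the two are
indistinguishable.

WHY PRINT AGREES (pointwise, refereed, no dual convention involved): [CastellaHsieh2018] construct
the `𝔭`-adic `ℒ_{𝔭,ψ}(f)` with interpolation at infinity type `(m, −m)`, `m ≥ 0`, on top of `ψ` of
type `(r, −r)` — total type `(n, −n)`, `n ≥ 1`, for weight `2` — and MULTIPLIER
`e_𝔭(f, χ) = (1 − a_p(f) p^{−r} χ_𝔭̄(p) + χ_𝔭̄(p²) p⁻¹)²` AT `𝔭̄` (Def. 3.5, Prop. 3.6 and the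
display defining `e_𝔭`, arXiv:1505.08165 pp. 10–11; held text chunks p0010 L16–L20, L85,
p0011 L7–L11): positive Hodge–Tate weight and NO multiplier at the strict prime `𝔭` of Def. 2.2's
`X_𝔭`.
[Castella2018] Thm. 3.1 names THIS function ("`L_p(f) := Tw_{ψ⁻¹}(ℒ_{𝔭,ψ}(f))`", proof, p. 9) but
prints the display with `𝔭` and `𝔭̄` exchanged (type `(−n, n)`, multiplier at `𝔭`) — the shape of
the `𝔭̄`-adic function, which is what the tree predicate `IsBDPLFunction ι 𝔭` copied. Reading the
erratum's Thm. 1.1 with its objects as DEFINED (Def. 2.2 + Castella–Hsieh's `ℒ_𝔭`) and applying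
it at the conjugate embedding datum gives exactly the statement below; reading it with Thm. 3.1's
display gives the sibling. The (C4) verdict memo of this seat
(pub/bsd-littype/staging/bsd-littype-05/C4-ORIENTATION-VERDICT.md, sha16 e1a2a1c6e35a839b; bsd-eis
c3h MEMO-2 reaches the same verdict tree-internally) has two further print anchors (Castella–Hsieh
Thm. 5.7 (eq:bdp) pointwise; Bertolini–Castella–Kwon (eq:TW)/(eq:PT): the school's `𝔛` is de facto
the contragredient dual) and the kernel-level checks; bsd-eis RULINGS L31/L33 fix the Selmer-side
repair ("(F1): `XAc … 𝔭 ↦ XAc … 𝔭bar` with `𝔭bar ∋ p`, `𝔭bar ≠ 𝔭`; one frame convention per tree")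
adopted here, as executed Summits-side by `X2.NonsplitIMCEqOnTreeIntOther` /
`X2.SplitIMCEqOnTreeIntOther` (Keller–Yin Thm. D's exact shape).

## The statement (verbatim source: sibling module docstring; erratum p. 1, held text
## `paper:url-e83251f1873d`)

"Let `E/ℚ` be an elliptic curve of conductor `N` with multiplicative reduction at `p > 3`, and let
`K` be an imaginary quadratic field such that there exists an ideal `𝔑 ⊂ 𝒪_K` with `𝒪_K/𝔑 ≃ ℤ/Nℤ`
and in which `p = 𝔭𝔭̄` splits. Assume that: (i) `E[p]` is irreducible as a `G_ℚ`-module. (ii) If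
`2` is nonsplit in `K`, then `2 ∥ N`. (iii) `E` has nonsplit multiplicative reduction at each prime
`q ∥ N` which is nonsplit in `K`, and that there is at least one such prime `q` at which `E[p]` is
ramified. (iv) `E(ℚ_p)[p] = 0`. Then `Ch_Λ(X_ac(E[p^∞]))` is `Λ`-torsion and
`Ch_Λ(X_ac(E[p^∞]))Λ_{R₀} = (L_p(f))`." Binders: VERBATIM those of the sibling fact (same
dictionary, same flags `Err11-Lp-nonsemistable`, `Err11-R0-receptacle`, `Err11-heegner-beta`,
`Err11-lower-half-by-analogy`, `Err11-dK-parity`), PLUS the datum of the other prime: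
`(𝔭bar : HeightOneSpectrum (𝓞 K))`, `p ∈ 𝔭bar`, `𝔭bar ≠ 𝔭` (Keller–Yin Thm. D layout). Conclusion:
a frame `(Ω_K ≠ 0, Ω_p ∈ R₀ˣ, L ∈ R₀⟦T⟧)` with `IsBDPLFunction ι 𝔭 κ γ f Ω_K Ω_p L`, `Λ`-torsion of
`AcSelmer.XAc (W.baseChange K) p κ 𝔭bar ∅ γ`, and along THE structure map `j : ℤ_p → R₀` the
equality `(Ch_Λ(X_ac strict at 𝔭̄)).map j = (L)` in `R₀⟦T⟧`.

## Contents

* `erratumThm11Reoriented_exists_isBDPLFunction_isTorsion_charIdeal_eq_OPEN` — the OPEN fact.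
* PROVED API: the one-sided form `…_le_…` (what divisibility consumers take); the torsion conjunct;
  the existence-of-frame conjunct (= the sibling's, same frame); and FORM (b) — [Castella2018]
  Def. 2.2's `X_𝔭` VERBATIM (strict at the prime a given embedding datum `ι` induces) paired with a
  frame at the OTHER datum `(ι'', 𝔭̄)`, `ι''` inducing `𝔭̄` — obtained from the fact by exchanging
  the roles of the two primes (`…_frameOther_…`).

STATUS: **PRE**, exactly as the sibling (erratum unrefereed; arXiv:2409.01360 v1-only; upper
divisibility via Fouquet–Wan arXiv:2107.13726 Thm. 4.41, unrefereed). What this is NOT: not a proof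
of anything in print; not an equivalence with the sibling fact (that would need the
complex-conjugation transport `XAc … 𝔭bar ≃ₛₗ[ι] XAc … 𝔭`, not in the tree); not a change of the
sibling's meaning.

## References

* [Castella2018Erratum] Thm. 1.1 (p. 1), §2 (p. 2: "`𝔭` the prime of `K` above `p` induced by
  `ı_p`"), Thm. 2.3, (2.4)–(2.5) (pp. 3–4). [Castella2024] arXiv:2409.01360v1 §3.1 Thm. 3.1.
* [Castella2018] Def. 2.2 (arXiv:1704.06608 p. 5: `Sel_𝔭` strict at `𝔭`), Thm. 3.1 and its proof
  (p. 9: the display; "`L_p(f) := Tw_{ψ⁻¹}(ℒ_{𝔭,ψ}(f))`").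
* [CastellaHsieh2018] §3.3 (arXiv:1505.08165 p. 9, chunk p0009 L34–L41: infinity type `(m, n)`,
  avatar `χ̂(z) = i_p i_∞⁻¹(χ(z)) z_𝔭^m z_𝔭̄^n`, `rec_K`; final TeX `padicL.tex` L322: "unramified
  twist of the `m`-th power of the `p`-adic cyclotomic character"), the multiplier `e_𝔭(f, χ)`
  (p. 10, p0010 L16–L20), Def. 3.5 (p0010 L85), Prop. 3.6 (p0011 L7–L11); Thm. 5.7 (eq:bdp).
* [BlochKato1990] §3 (`H¹_f`; (3.7)–(3.8), pp. 353–354). [CastellaGrossiLeeSkinner2022] §1.4,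
  Thm. 2.1.1, Conj. 1.4.2 / Thm. 4.2.2 (the good-reduction sibling's layout: frame at `v`, `𝔛` at
  `v̄`).
* [BurungaleCastellaKim2021] (2.2)–(2.4) (`𝐖 ≃ Hom(𝐓, μ_{p^∞})`, the contragredient mechanism).
* Tree: sibling `Castella2018/AnticyclotomicMainConjectureErratum.lean`; family-B binders
  `KellerYin2024/MultiplicativeReduction.lean` (`thmD_…_OPEN`),
  `CastellaGrossiLeeSkinner2022/IMC2DivisibilityAndBDPValueFrame.lean` (`proofThm422_…`);
  Summits-side re-oriented atoms `X2.NonsplitIMCEqOnTreeIntOther` / `X2.SplitIMCEqOnTreeIntOther`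
  and `Theorems/EisensteinPrimesBSDpOnCellCStubC3Reoriented.lean` (not imported: Literature never
  imports Summits).
-/

noncomputable section

open scoped Classical

open PowerSeries WeierstrassCurve NumberField IsDedekindDomain Field
  Literature.NumberTheory.EllipticCurves Literature.NumberTheory.EllipticCurves.ModularForms
  Literature.NumberTheory.EllipticCurves.Rank1Residual

namespace Literature.NumberTheory.EllipticCurves.Castella2018

/-! ### §1 The OPEN fact, re-oriented: frame at `(ι, 𝔭)`, `X_ac` strict at `𝔭̄` -/

section Fact

/-- **OPEN HYPOTHESIS — UNREFEREED (Castella, web erratum to Camb. J. Math. 6 (2018), Thm. 1.1;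
= Castella, arXiv:2409.01360v1, Thm. 3.1; upper divisibility of its proof = Fouquet–Wan
arXiv:2107.13726 Thm. 4.41, unrefereed), CORRECTLY ORIENTED twin of
`erratumThm11_exists_isBDPLFunction_isTorsion_charIdeal_eq_OPEN`.** Verbatim (erratum p. 1): "Let
`E/ℚ` be an elliptic curve of conductor `N` with multiplicative reduction at `p > 3`, and let `K` be
an imaginary quadratic field such that there exists an ideal `𝔑 ⊂ 𝒪_K` with `𝒪_K/𝔑 ≃ ℤ/Nℤ` and in
which `p = 𝔭𝔭̄` splits. Assume that: (i) `E[p]` is irreducible as a `G_ℚ`-module. (ii) If `2` is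
nonsplit in `K`, then `2 ∥ N`. (iii) `E` has nonsplit multiplicative reduction at each prime `q ∥ N`
which is nonsplit in `K`, and that there is at least one such prime `q` at which `E[p]` is ramified.
(iv) `E(ℚ_p)[p] = 0`. Then `Ch_Λ(X_ac(E[p^∞]))` is `Λ`-torsion and `Ch_Λ(X_ac(E[p^∞]))Λ_{R₀} =
(L_p(f))`." ORIENTATION (module docstring; bsd-eis RULING L33 (F1)): `X_ac` = [Castella2018]
Def. 2.2's dual of the Selmer group STRICT at one prime above `p` and `L_p(f) =
Tw_{ψ⁻¹}(ℒ_{𝔭,ψ}(f))` = Castella–Hsieh's function, whose avatars have POSITIVE Hodge–Tate weight at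
that strict prime and whose multiplier `e_𝔭(f,χ)` sits at the OTHER prime ([CastellaHsieh2018] §3.3,
Def. 3.5, Prop. 3.6); the tree frame `IsBDPLFunction ι 𝔭` (ι inducing `𝔭`; [Castella2018] Thm. 3.1's
display: type `(−n, n)`, multiplier at `𝔭`) has NEGATIVE weight at `𝔭` and positive at `𝔭̄`, so —
for the tree's PRECOMPOSITION duals `AcSelmer.XAc` (Bloch–Kato / Greenberg, as in the family-B
binders `KellerYin2024.thmD_…_OPEN`, `CastellaGrossiLeeSkinner2022.proofThm422_…`) — its partner is
`X_ac` STRICT AT `𝔭̄`. TRANSCRIBED (binders VERBATIM those of the sibling fact, plus the other prime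
`𝔭bar ∋ p`, `𝔭bar ≠ 𝔭`): for `W/ℚ` globally minimal with newform `f` of level `N = N_W`, `3 < p`,
`Mult W p`; `K` imaginary quadratic with `d_K ≡ β² (mod 4N)` for some `β`, `p` split, `𝔭 ∋ p` the
prime singled out by the embedding datum `ι`, `𝔭bar ∋ p` the other one; (i) `Irr W p`; (ii); (iii);
(iv); `κ` anticyclotomic with topological generator `γ`: **there are `Ω_K ≠ 0`, `Ω_p ∈ R₀ˣ`,
`L ∈ R₀⟦T⟧` with `IsBDPLFunction ι 𝔭 κ γ f Ω_K Ω_p L` such that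
`X_ac = AcSelmer.XAc (W.baseChange K) p κ 𝔭bar ∅ γ` (STRICT AT `𝔭bar`) is `Λ`-torsion and, along
THE structure map `j : ℤ_p → R₀`, `Ch_Λ(X_ac)·R₀⟦T⟧ = (L)`.** All flags of the sibling
(`Err11-Lp-nonsemistable`, `Err11-R0-receptacle`, `Err11-heegner-beta`,
`Err11-lower-half-by-analogy`, `Err11-dK-parity`) apply verbatim. NEVER cite this `Prop` as a
theorem: take it as an explicit hypothesis; a result using it is conditional on unrefereed claims
(the erratum; arXiv:2409.01360; arXiv:2107.13726 Thm. 4.41 via erratum (2.4)).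
[claim: Castella2018Erratum, status: under-review]
[cite: Castella2018, Def. 2.2 (arXiv:1704.06608 p. 5) and Thm. 3.1 with its proof (p. 9) (the objects `X_ac`, `L_p(f) := Tw_{ψ⁻¹}(ℒ_{𝔭,ψ}(f))`; shape only, nothing asserted)]
[cite: CastellaHsieh2018, §3.3 (p. 9), Def. 3.5 and Prop. 3.6 (pp. 10–11) (infinity type / avatar convention; the multiplier `e_𝔭(f,χ)` at `𝔭̄`; orientation only, nothing asserted)] -/
def erratumThm11Reoriented_exists_isBDPLFunction_isTorsion_charIdeal_eq_OPEN : Prop :=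
  ∀ {p : ℕ} [Fact p.Prime] (ι : PadicAlgCl p ≃+* ℂ) (W : WeierstrassCurve ℚ) [W.IsElliptic]
    [W.IsGloballyMinimal] (K : Type) [Field K] [NumberField K]
    (𝔭 𝔭bar : HeightOneSpectrum (𝓞 K)) (κ : ZpExtension K p) (γ : absoluteGaloisGroup K)
    [Fact (κ.IsTopGenerator γ)] {N : ℕ} [NeZero N] {f : CuspForm (CongruenceSubgroup.Gamma0 N) 2}
    (_ : IsNewformOf W f),
    -- "`E/ℚ` an elliptic curve of conductor `N` with multiplicative reduction at `p > 3`"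
    W.conductorNorm ℤ = N → 3 < p → Mult W p →
    -- "`K` imaginary quadratic … `𝒪_K/𝔑 ≃ ℤ/Nℤ` … in which `p = 𝔭𝔭̄` splits"
    IsImaginaryQuadratic K → (∃ β : ℤ, (4 * N : ℤ) ∣ β ^ 2 - NumberField.discr K) →
    ((Ideal.span {(p : ℤ)}).primesOver (𝓞 K)).ncard = 2 →
    -- `𝔭 ∋ p` induced by the embedding datum `ι` (through which the frame reads infinity types)
    ((p : ℕ) : 𝓞 K) ∈ 𝔭.asIdeal →
    (∀ (w : InfinitePlace K) (k : 𝓞 K), k ∈ 𝔭.asIdeal ↔ ‖ι.symm (w.embedding (k : K))‖ < 1) →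
    -- `𝔭bar ∋ p` THE OTHER prime above `p` (Keller–Yin Thm. D layout; RULING L33 (F1))
    ((p : ℕ) : 𝓞 K) ∈ 𝔭bar.asIdeal → 𝔭bar ≠ 𝔭 →
    -- (i) `E[p]` irreducible
    Irr W p →
    -- (ii) "if `2` is nonsplit in `K`, then `2 ∥ N`"
    (((Ideal.span {(2 : ℤ)}).primesOver (𝓞 K)).ncard ≠ 2 → Mult W 2) →
    -- (iii) nonsplit multiplicative at every `q ∥ N` nonsplit in `K`; one such `q` with `E[p]`
    -- ramified
    (∀ (q : ℕ) [Fact q.Prime], Mult W q → ((Ideal.span {(q : ℤ)}).primesOver (𝓞 K)).ncard ≠ 2 →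
      ¬ W.HasSplitMultiplicativeReductionAtPrime q) →
    (∃ (q : ℕ) (_ : Fact q.Prime), Mult W q ∧ ((Ideal.span {(q : ℤ)}).primesOver (𝓞 K)).ncard ≠ 2 ∧
      ¬ p ∣ padicValInt q W.minimalDiscriminantInt) →
    -- (iv) `E(ℚ_p)[p] = 0`
    (∀ P : (W.baseChange ℚ_[p]).toAffine.Point, p • P = 0 → P = 0) →
    -- `Λ = ℤ_p[[Γ]]`, `Γ = Gal(K_∞/K)` THE anticyclotomic `ℤ_p`-extension
    κ.IsAnticyclotomic →
    ∃ (ΩK : ℂ) (Ωp : (unrIntegers p)ˣ) (L : UnrSeries p),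
      ΩK ≠ 0 ∧ IsBDPLFunction ι 𝔭 κ γ f ΩK ((Ωp : unrIntegers p) : ℂ_[p]) L ∧
      Module.IsTorsion (IwasawaAlgebra p) (AcSelmer.XAc (W.baseChange K) p κ 𝔭bar ∅ γ) ∧
      ∀ (j : ℤ_[p] →+* unrIntegers p),
        (∀ x : ℤ_[p], ((j x : unrIntegers p) : ℂ_[p]) = algebraMap ℚ_[p] ℂ_[p] (x : ℚ_[p])) →
        (AcSelmer.XAc.charIdeal (W.baseChange K) p κ 𝔭bar ∅ γ).map (PowerSeries.map j) =
          Ideal.span {L}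

end Fact

/-! ### §2 API (proved): one-sided form, torsion, the frame conjunct, and form (b) -/

section API

variable {p : ℕ} [Fact p.Prime] (ι : PadicAlgCl p ≃+* ℂ) (W : WeierstrassCurve ℚ) [W.IsElliptic]
  [W.IsGloballyMinimal] (K : Type) [Field K] [NumberField K] (𝔭 𝔭bar : HeightOneSpectrum (𝓞 K))
  (κ : ZpExtension K p) (γ : absoluteGaloisGroup K) [Fact (κ.IsTopGenerator γ)] {N : ℕ} [NeZero N]
  {f : CuspForm (CongruenceSubgroup.Gamma0 N) 2} (hf : IsNewformOf W f)
  (hN : W.conductorNorm ℤ = N) (hp : 3 < p) (hmult : Mult W p) (hK : IsImaginaryQuadratic K)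
  (hHeeg : ∃ β : ℤ, (4 * N : ℤ) ∣ β ^ 2 - NumberField.discr K)
  (hsplit : ((Ideal.span {(p : ℤ)}).primesOver (𝓞 K)).ncard = 2)
  (h𝔭 : ((p : ℕ) : 𝓞 K) ∈ 𝔭.asIdeal)
  (hcompat : ∀ (w : InfinitePlace K) (k : 𝓞 K),
    k ∈ 𝔭.asIdeal ↔ ‖ι.symm (w.embedding (k : K))‖ < 1)
  (h𝔭bar : ((p : ℕ) : 𝓞 K) ∈ 𝔭bar.asIdeal) (hne : 𝔭bar ≠ 𝔭)
  (hirr : Irr W p) (h2 : ((Ideal.span {(2 : ℤ)}).primesOver (𝓞 K)).ncard ≠ 2 → Mult W 2)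
  (hns : ∀ (q : ℕ) [Fact q.Prime], Mult W q →
    ((Ideal.span {(q : ℤ)}).primesOver (𝓞 K)).ncard ≠ 2 → ¬ W.HasSplitMultiplicativeReductionAtPrime q)
  (hram : ∃ (q : ℕ) (_ : Fact q.Prime), Mult W q ∧
    ((Ideal.span {(q : ℤ)}).primesOver (𝓞 K)).ncard ≠ 2 ∧ ¬ p ∣ padicValInt q W.minimalDiscriminantInt)
  (htors : ∀ P : (W.baseChange ℚ_[p]).toAffine.Point, p • P = 0 → P = 0)
  (hκ : κ.IsAnticyclotomic)

include hf hN hp hmult hK hHeeg hsplit h𝔭 hcompat h𝔭bar hne hirr h2 hns hram htors hκ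

/-- **The one-sided divisibility `Ch_Λ(X_ac strict at 𝔭̄)·Λ_{R₀} ⊆ (L_p(f))` from the re-oriented
OPEN equality** — the shape that erratum (2.4) ⇒ (2.5) descends to ("`Ch_{Λ_𝒪}(X^Σ_ac)Λ_𝒪^{ur} ⊂
(L^Σ_p)`", p. 4) and that divisibility consumers take; same binders, `≤` in place of `=`
(`le_of_eq`). CONDITIONAL on the OPEN fact; nothing asserted.
[claim: Castella2018Erratum, status: under-review] -/
theorem exists_isBDPLFunction_isTorsion_charIdeal_le_of_erratumThm11Reoriented_OPEN
    (h : erratumThm11Reoriented_exists_isBDPLFunction_isTorsion_charIdeal_eq_OPEN) :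
    ∃ (ΩK : ℂ) (Ωp : (unrIntegers p)ˣ) (L : UnrSeries p),
      ΩK ≠ 0 ∧ IsBDPLFunction ι 𝔭 κ γ f ΩK ((Ωp : unrIntegers p) : ℂ_[p]) L ∧
      Module.IsTorsion (IwasawaAlgebra p) (AcSelmer.XAc (W.baseChange K) p κ 𝔭bar ∅ γ) ∧
      ∀ (j : ℤ_[p] →+* unrIntegers p),
        (∀ x : ℤ_[p], ((j x : unrIntegers p) : ℂ_[p]) = algebraMap ℚ_[p] ℂ_[p] (x : ℚ_[p])) →
        (AcSelmer.XAc.charIdeal (W.baseChange K) p κ 𝔭bar ∅ γ).map (PowerSeries.map j) ≤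
          Ideal.span {L} := by
  obtain ⟨ΩK, Ωp, L, hΩ, hL, hT, hEq⟩ :=
    h ι W K 𝔭 𝔭bar κ γ hf hN hp hmult hK hHeeg hsplit h𝔭 hcompat h𝔭bar hne hirr h2 hns hram htors hκ
  exact ⟨ΩK, Ωp, L, hΩ, hL, hT, fun j hj ↦ le_of_eq (hEq j hj)⟩

/-- **The torsion conjunct: `X_ac(E[p^∞])` STRICT AT `𝔭̄` is `Λ`-torsion on the locus of Thm. 1.1**
(erratum p. 1: "`Ch_Λ(X_ac(E[p^∞]))` is `Λ`-torsion"), re-oriented. CONDITIONAL on the OPEN fact;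
nothing asserted. [claim: Castella2018Erratum, status: under-review] -/
theorem isTorsion_XAc_other_of_erratumThm11Reoriented_OPEN
    (h : erratumThm11Reoriented_exists_isBDPLFunction_isTorsion_charIdeal_eq_OPEN) :
    Module.IsTorsion (IwasawaAlgebra p) (AcSelmer.XAc (W.baseChange K) p κ 𝔭bar ∅ γ) := by
  obtain ⟨-, -, -, -, -, hT, -⟩ :=
    h ι W K 𝔭 𝔭bar κ γ hf hN hp hmult hK hHeeg hsplit h𝔭 hcompat h𝔭bar hne hirr h2 hns hram htors hκ
  exact hT

/-- **The frame conjunct: a BDP frame `(Ω_K ≠ 0, Ω_p ∈ R₀ˣ, L ∈ R₀⟦T⟧)` at `(ι, 𝔭)`, `p ∥ N`, on the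
locus of Thm. 1.1** — the SAME frame statement as the sibling's
`exists_isBDPLFunction_of_erratumThm11_OPEN` (re-orientation moves the Selmer slot, not the frame):
A206's conclusion without A206's `Squarefree N` (flag `Err11-Lp-nonsemistable`, kernel-visible).
CONDITIONAL on the OPEN fact; nothing asserted.
[claim: Castella2018Erratum, status: under-review] -/
theorem exists_isBDPLFunction_of_erratumThm11Reoriented_OPEN
    (h : erratumThm11Reoriented_exists_isBDPLFunction_isTorsion_charIdeal_eq_OPEN) :
    ∃ (ΩK : ℂ) (Ωp : (unrIntegers p)ˣ) (L : UnrSeries p),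
      ΩK ≠ 0 ∧ IsBDPLFunction ι 𝔭 κ γ f ΩK ((Ωp : unrIntegers p) : ℂ_[p]) L := by
  obtain ⟨ΩK, Ωp, L, hΩ, hL, -, -⟩ :=
    h ι W K 𝔭 𝔭bar κ γ hf hN hp hmult hK hHeeg hsplit h𝔭 hcompat h𝔭bar hne hirr h2 hns hram htors hκ
  exact ⟨ΩK, Ωp, L, hΩ, hL⟩

omit hcompat in
/-- **FORM (b) — [Castella2018] Def. 2.2's `X_𝔭` VERBATIM (strict at `𝔭`) is the partner of a frame
at the OTHER embedding datum.** If `ι''` is an embedding datum inducing `𝔭̄` (`k ∈ 𝔭̄ ↔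
‖ι''⁻¹(w.embedding k)‖ < 1`; Castella–Hsieh's `ℒ_𝔭`-shape: positive Hodge–Tate weight at `𝔭`,
multiplier at `𝔭̄`), then on the locus of Thm. 1.1 there is a frame `(Ω_K ≠ 0, Ω_p ∈ R₀ˣ, L)` with
`IsBDPLFunction ι'' 𝔭bar κ γ f Ω_K Ω_p L` such that `AcSelmer.XAc (W.baseChange K) p κ 𝔭 ∅ γ`
(STRICT AT `𝔭`, literally the sibling's module) is `Λ`-torsion and `Ch_Λ(X_ac strict at 𝔭)·R₀⟦T⟧
= (L)` along THE structure map. Proof: the fact with the roles of `𝔭` and `𝔭̄` exchanged (its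
hypotheses are symmetric in the two primes). CONDITIONAL on the OPEN fact; nothing asserted.
[claim: Castella2018Erratum, status: under-review]
[cite: Castella2018, Def. 2.2 (arXiv:1704.06608 p. 5) (the module `X_𝔭`; shape only, nothing asserted)] -/
theorem exists_isBDPLFunction_frameOther_isTorsion_charIdeal_eq_of_erratumThm11Reoriented_OPEN
    (h : erratumThm11Reoriented_exists_isBDPLFunction_isTorsion_charIdeal_eq_OPEN)
    (ι'' : PadicAlgCl p ≃+* ℂ)
    (hcompat'' : ∀ (w : InfinitePlace K) (k : 𝓞 K),
      k ∈ 𝔭bar.asIdeal ↔ ‖ι''.symm (w.embedding (k : K))‖ < 1) :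
    ∃ (ΩK : ℂ) (Ωp : (unrIntegers p)ˣ) (L : UnrSeries p),
      ΩK ≠ 0 ∧ IsBDPLFunction ι'' 𝔭bar κ γ f ΩK ((Ωp : unrIntegers p) : ℂ_[p]) L ∧
      Module.IsTorsion (IwasawaAlgebra p) (AcSelmer.XAc (W.baseChange K) p κ 𝔭 ∅ γ) ∧
      ∀ (j : ℤ_[p] →+* unrIntegers p),
        (∀ x : ℤ_[p], ((j x : unrIntegers p) : ℂ_[p]) = algebraMap ℚ_[p] ℂ_[p] (x : ℚ_[p])) →
        (AcSelmer.XAc.charIdeal (W.baseChange K) p κ 𝔭 ∅ γ).map (PowerSeries.map j) =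
          Ideal.span {L} :=
  h ι'' W K 𝔭bar 𝔭 κ γ hf hN hp hmult hK hHeeg hsplit h𝔭bar hcompat'' h𝔭 (Ne.symm hne) hirr h2 hns
    hram htors hκ

end API

end Literature.NumberTheory.EllipticCurves.Castella2018

end
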